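import Summits.BirchSwinnertonDyer.Rank1Residual.X11b.Three.ImageSah
import Mathlib.LinearAlgebra.Matrix.Notation
import Mathlib.GroupTheory.Index
import HarnessLib

/-!
# X11b at `p = 3` (team N8/O2), S7 · IMG3b supplement: the hypothesis "`−1 ∈ G`" of Sah's lemma
# holds for EVERY subgroup of index `≤ 2` of `GL₂(R)` — in particular for the image of `G_K`
# (`K` quadratic) whenever `ρ_{E,3^m}` is onto `GL₂(ℤ/3^m)`

HONEST FRAMING (cell `b2b-bsdres`, run/shared/lean/b2b/bsd-rank1-residual/, verbatim in every
file): the goal of the cell is to DELETE the COMBINATION-SHAPED residual classes of the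
Birch–Swinnerton-Dyer formula for ALL analytic-rank `≤ 1` elliptic curves over `ℚ` — "full BSD
formula for every rank `≤ 1` curve in class `C`" assembled STRICTLY from published theorems — so
that the rank-`≤ 1` remainder becomes exactly the CONSTRUCTION-SHAPED classes, which are TYPED
(missing-input `Prop`s), NOT attempted. This is not "finishing BSD". Team N8/O2 = `x11b3` (X11b at
`p = 3`), seat `b2b-bsdres-x11b3-p1`, supplement to sub-target S7 (`ImageSah.lean`). Pure group
theory; nothing is booked; no label changes. THEOREMS ONLY (no definition, no named fact, no
`sorry`).

## What and why

`ImageSah.lean` kills `H¹(G, (ℤ/3^m)²)` and the `G`-invariants under the hypothesis `−1 ∈ G`, which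
the team lead flagged (2026-08-21T05:07Z) as "NOT automatic from level `3`; state it as the
hypothesis at each level; under `towerSurj(3)` it holds". This file records WHY it holds, at the
level of groups and for every commutative ring `R`: `−1 = w²` for `w = (0 −1; 1 0) ∈ SL₂(R)`, and a
subgroup of index `2` contains every square (`Subgroup.mul_self_mem_of_index_two`). Hence:

* `GL2.neg_one_eq_rot_sq` — `−1 = w * w` in `GL₂(R)`;
* `GL2.neg_one_mem_of_index_dvd_two` — every `H ≤ GL₂(R)` with `[GL₂(R) : H] ∣ 2` contains `−1`;
* `GL2.neg_one_mem_map_of_index_two` — for `ρ : Γ →* GL₂(R)` ONTO and `Γ' ≤ Γ` of index `2`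
  (dictionary: `Γ' = G_K` for a quadratic `K`, `ρ = ρ_{E,3^m}` under `towerSurj(3)`):
  `−1 ∈ ρ(Γ')` — with NO condition on `K` (contrast S6: surjectivity of `ρ̄|_{G_K}` needs
  `K ≠ ℚ(√−3)`; the weaker `−1 ∈ ρ(G_K)` does not);
* `GL2.neg_one_mem_map_of_index_two_of_le` — the same for any `Γ'' ≤ Γ'` whose image still has
  index `∣ 2` in `ρ(Γ')`… stated in the useful form: for `Γ'' ≤ Γ` with `ρ(Γ'')` of index dividing
  `2` in `GL₂(R)`;
* the assembled S7 statements WITHOUT the `−1 ∈ G` binder for such images over `R = ℤ/3^m`: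
  `GL2.eq_zero_of_forall_mulVec_eq_of_index_two` (no fixed vectors of `ρ(Γ')`) and
  `GL2.exists_eq_mulVec_sub_of_crossedHom_of_index_two` (every crossed homomorphism of `ρ(Γ')`
  with values in `(ℤ/3^m)²` is principal).

The passage from `ρ(G_K)` to the anticyclotomic layers `ρ(G_{K_n})` (index `3^n`, a `3`-group
quotient, so the order-`2` element `−1` survives) is S3's (p9) and is not done here.

References: standard; team files `cells/x11b3/PLAN.md` §2 S7, lead's note INBOX 2026-08-21T05:07Z.
-/

namespace Summit.BirchSwinnertonDyer.Rank1Residual.X11b.Three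

namespace GL2

open Matrix

section AnyRing

variable {R : Type*} [CommRing R]

/-- The rotation `w = (0 −1; 1 0) ∈ GL₂(R)` (determinant `1`). [folklore] -/
theorem isUnit_det_rot : IsUnit (!![(0 : R), -1; 1, 0]).det := by
  rw [Matrix.det_fin_two_of]; simp

/-- **`−1 = w²` in `GL₂(R)`** for `w = (0 −1; 1 0)`. [folklore] -/
theorem neg_one_eq_rot_sq :
    (-1 : GL (Fin 2) R) =
      Matrix.GeneralLinearGroup.mk'' (!![(0 : R), -1; 1, 0]) isUnit_det_rot *
        Matrix.GeneralLinearGroup.mk'' (!![(0 : R), -1; 1, 0]) isUnit_det_rot := by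
  apply Matrix.GeneralLinearGroup.ext
  intro i j
  rw [Units.val_neg, Units.val_one, Units.val_mul]
  change (-1 : Matrix (Fin 2) (Fin 2) R) i j = (!![(0 : R), -1; 1, 0] * !![(0 : R), -1; 1, 0]) i j
  rw [Matrix.mul_fin_two]
  fin_cases i <;> fin_cases j <;> simp

/-- **Every subgroup of `GL₂(R)` of index dividing `2` contains `−1`** (it contains all squares,
and `−1 = w²`). [folklore] -/
theorem neg_one_mem_of_index_dvd_two (H : Subgroup (GL (Fin 2) R)) (hH : H.index ∣ 2) :
    (-1 : GL (Fin 2) R) ∈ H := by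
  rcases (Nat.dvd_prime Nat.prime_two).mp hH with h1 | h2
  · rw [Subgroup.index_eq_one] at h1
    rw [h1]; exact Subgroup.mem_top _
  · rw [neg_one_eq_rot_sq]
    exact Subgroup.mul_self_mem_of_index_two h2 _

variable {Γ : Type*} [Group Γ]

/-- **`−1 ∈ ρ(Γ')` for every index-`2` subgroup `Γ'` when `ρ : Γ → GL₂(R)` is onto** (the image
`ρ(Γ')` has index dividing `2`). Dictionary: `Γ' = G_K ≤ G_ℚ = Γ` for a quadratic field `K`,
`ρ = ρ_{E,3^m}` onto `GL₂(ℤ/3^m)` (`towerSurj(3)`); no condition on `K`. [folklore] -/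
theorem neg_one_mem_map_of_index_two (ρ : Γ →* GL (Fin 2) R) (hρ : Function.Surjective ρ)
    (Γ' : Subgroup Γ) (hΓ' : Γ'.index = 2) : (-1 : GL (Fin 2) R) ∈ Γ'.map ρ := by
  have h : (Γ'.map ρ).index ∣ Γ'.index := Subgroup.index_map_dvd Γ' hρ
  rw [hΓ'] at h
  exact neg_one_mem_of_index_dvd_two _ h

/-- More generally: `−1 ∈ ρ(Γ'')` for every `Γ'' ≤ Γ` whose index divides `2`, `ρ` onto.
[folklore] -/
theorem neg_one_mem_map_of_index_dvd_two (ρ : Γ →* GL (Fin 2) R) (hρ : Function.Surjective ρ)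
    (Γ'' : Subgroup Γ) (hΓ'' : Γ''.index ∣ 2) : (-1 : GL (Fin 2) R) ∈ Γ''.map ρ :=
  neg_one_mem_of_index_dvd_two _ (dvd_trans (Subgroup.index_map_dvd Γ'' hρ) hΓ'')

end AnyRing

/-! ### The S7 statements for images of index-`2` subgroups, `R = ℤ/3^m`, without the binder -/

section ThreePow

variable {m : ℕ} {Γ : Type*} [Group Γ]

/-- **No fixed vectors of `ρ(Γ')`** for `ρ : Γ → GL₂(ℤ/3^m)` onto and `Γ'` of index `2`: a
vector of `(ℤ/3^m)²` fixed by every element of `ρ(Γ')` is `0`. [folklore] -/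
theorem eq_zero_of_forall_mulVec_eq_of_index_two (ρ : Γ →* GL (Fin 2) (ZMod (3 ^ m)))
    (hρ : Function.Surjective ρ) (Γ' : Subgroup Γ) (hΓ' : Γ'.index = 2)
    (v : Fin 2 → ZMod (3 ^ m))
    (hv : ∀ γ ∈ Γ', ((ρ γ : GL (Fin 2) (ZMod (3 ^ m))) : Matrix (Fin 2) (Fin 2) (ZMod (3 ^ m))) *ᵥ v = v) :
    v = 0 := by
  refine eq_zero_of_forall_mulVec_eq (Γ'.map ρ) (neg_one_mem_map_of_index_two ρ hρ Γ' hΓ') v ?_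
  rintro g ⟨γ, hγ, rfl⟩
  exact hv γ hγ

/-- **Every crossed homomorphism of `ρ(Γ')` into `(ℤ/3^m)²` is principal** for `ρ : Γ → GL₂(ℤ/3^m)`
onto and `Γ'` of index `2` (`H¹(ρ(Γ'), (ℤ/3^m)²) = 0`; Sah with `−1 ∈ ρ(Γ')` automatic).
[folklore] -/
theorem exists_eq_mulVec_sub_of_crossedHom_of_index_two (ρ : Γ →* GL (Fin 2) (ZMod (3 ^ m)))
    (hρ : Function.Surjective ρ) (Γ' : Subgroup Γ) (hΓ' : Γ'.index = 2)
    (f : Γ'.map ρ → (Fin 2 → ZMod (3 ^ m)))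
    (hf : ∀ g h : Γ'.map ρ, f (g * h) =
      ((g : GL (Fin 2) (ZMod (3 ^ m))) : Matrix (Fin 2) (Fin 2) (ZMod (3 ^ m))) *ᵥ f h + f g) :
    ∃ a : Fin 2 → ZMod (3 ^ m), ∀ g : Γ'.map ρ,
      f g = ((g : GL (Fin 2) (ZMod (3 ^ m))) : Matrix (Fin 2) (Fin 2) (ZMod (3 ^ m))) *ᵥ a - a :=
  exists_eq_mulVec_sub_of_crossedHom (Γ'.map ρ) (neg_one_mem_map_of_index_two ρ hρ Γ' hΓ') f hf

end ThreePow

end GL2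

end Summit.BirchSwinnertonDyer.Rank1Residual.X11b.Three
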